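import Literature.AnabelianGeometry.EtaleTheta.Discharge.Sec5CyclotomicRigidityOfBiKummerData
import Literature.AnabelianGeometry.EtaleTheta.Discharge.Sec5DeltaTransportCompat
import HarnessLib

/-!
# [EtTh] Thm. 5.6, step T56-L09 («hBN») at the assembled §5 data (abc-iut L2, sub-DAG SUBDAG-EtTh-Thm56, K4 line)

PROOF-ONLY.  abc-iut-w5-d020's abstract `Thm56Sub.transportAtBN_of` (p417981: abc-iut-L2-d4's hypothesis `hBN` of
`thm56_of_transport` — at `B_N`, `Ψ` carries the rigidity isomorphism `ρ_{B_N}(x)` to `ρ_{Ψ B_N}(aΨ x)`) is instantiated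
at abc-iut-L2-t4's `ThetaFrobenioid.ofBiKummerData`, with the following inputs DISCHARGED BY NAME:

* `[Epi sCap]`, `[Epi sCup]` — total epimorphicity of the model Frobenioid (`epi_of_model`, [FrdI] Thm 5.2);
* `hcap`, `hcup` — the defining relations of `s^⊓-gp_N`, `s^⊔-gp_N` (t4's `sgpCapSpec_ofBiKummerData`, `sgpCupSpec_ofBiKummerData`);
* `hcentral` — T56-L09b (this seat, `unitsCentralUnderLDelta_ofBiKummerData`, p419587; mod `hσ`, `hgeom`, `hconst`);
* `hspec` — `unitsPullSpec_ofBiKummerData` (this seat, p420099);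
* `hcompat` — T56-L09c `DeltaTransportCompat` (abc-iut-w5-d013's `Thm56Sub.deltaTransportCompat_ofBiKummerData`, p420747; mod
  its printed relations `hγ`, `hγL`, `haΨ` and the row-2 laws `hpre`, `hP`, `hcov'`);
* `hcov` — coverage `LDeltaCovered` (abc-iut-w5-d123's `lDeltaCovered_ofBiKummerData`, p419020; mod `e`, `he`, `hpre`, `hP`).

What stays NAMED (binders, no new `Prop` constants): `hdiff` (`BiKummerDifferenceMem` — itself a theorem for these data,
`biKummerDifferenceMem_ofBiKummerData` of `Discharge/Sec5OfBiKummerDataKummer.lean`, mod `hσ hH hfrac haut`; kept as a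
binder to keep this file's imports light), the `Ψ`-transport of the two sections `hT`, `hT'`, `hu` and the structure
transport `hstrv`, `hYdd` (abc-iut-L2-t9 MERGE-PLAN row 2 / [EtTh] Thm 5.6 proof p.329), and the rigidity family `ρ` with
its Prop. 5.5 properties `hK`, `hρ` (supplied by `cyclotomicRigidity_ofBiKummerData_of_laws`).
No side taken on [IUTchIII] Cor. 3.12; typed ≠ proved for the named binders.
[cite: MochizukiEtTh2009, Thm 5.6 proof p.329 (PDF p.103)]
-/

noncomputable section

namespace Literature.AnabelianGeometry.EtaleTheta

open CategoryTheory Opposite FrobenioidCyclotomicRigidity Literature.AlgebraicGeometry.Frobenioids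

universe u₀ v₀ u v w

namespace ThetaFrobenioid

variable {K : Type u₀} [Field K]
  {X : SemiGraphs.TemperedArithmeticGroup.{u₀} K} {D₀ : Type u₀} [Category.{v₀} D₀]
  {V : FrdIMonoidStub.{w}} {T₀ : RealifiedDivisorMonoids (D₀ := D₀) V} {D : Type u} [Category.{v} D]
  {VD : FrdICatStub.{u, v, w} D} {S : BiKummerSetting X T₀ D VD}
  {pullFrac : ∀ {A A' : S.C} (_ : A' ⟶ A), S.biratUnits A → S.biratUnits A'}
  {lv N : ℕ+} {l' : ℕ} {RD : RigidData.{max v w} N l'} {θ : S.biratUnits S.Aodot} {Bl : S.C}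
  {Pl : S.FractionPair θ Bl} {Rl : S.NthRoot θ Pl lv pullFrac}
  (h : ModelFrobenioid.Hypotheses S.tf.divisorMonoid S.tf.ratFnFunctor)
  (toB : ∀ A : S.C, S.biratUnits A →* S.tf.biratUnitsModel A) (Q : FrobenioidTheta.ThetaSubquotientStub.{w} D)
  (odd_l : Odd (lv : ℕ)) (R : S.NthRoot Rl.root Rl.pair N pullFrac) (ιX : RD.PiX ≃ₜ* X.Pi)
  (hopen : IsOpen ((S.galoisSurj R.AN.base R.αData.isGalois).ker : Set X.Pi)) (σ : Aut R.AN.base →* Aut R.AN)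
  (K' : Type w) [Field K'] (constEmb : K'ˣ →* S.tf.biratUnitsModel R.BN)
  (constEmb_injective : Function.Injective constEmb)
  (hdivc : ∀ g : Aut R.BN.base,
    ModelFrobenioid.div ((σ ((BiKummerSetting.NthRoot.baseIso S R).conjAut.symm g)).hom ≫ R.pair.num) =
      ModelFrobenioid.div R.pair.num)
  (hdivp : ∀ y : RD.PiYdd,
    ModelFrobenioid.div ((σ (S.galoisSurj R.AN.base R.αData.isGalois (ιX y.1))).hom ≫ R.pair.den) =
      ModelFrobenioid.div R.pair.den)

/-- **T56-L09 («hBN») at the assembled §5 data**: for a self-equivalence `Ψ` of the tempered Frobenioid transported to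
`A_N`, `B_N` (`α`, `β`, `eA`, `Dp`, base shadow `θΨ`) compatibly with the sections and the theta structure, and a
rigidity family `ρ` with the Prop. 5.5 properties, `Ψ(ρ_{B_N}(x)) = ρ_{Ψ B_N}(aΨ_{B_N} x)` on `(l·Δ_Θ)_{B_N} ⊗ ℤ/N` —
abc-iut-w5-d020's `Thm56Sub.transportAtBN_of` with total epimorphicity, the section relations, units-centrality
(T56-L09b), `UnitsPullSpec`, `DeltaTransportCompat` (T56-L09c, abc-iut-w5-d013) and coverage discharged by name.
[cite: MochizukiEtTh2009, Thm 5.6 proof p.329 (PDF p.103)] -/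
theorem transportAtBN_ofBiKummerData
    (Ψ : S.C ≌ S.C) (α : Ψ.functor.obj (ofBiKummerData h toB Q odd_l R ιX hopen σ K' constEmb constEmb_injective hdivc hdivp).AN ≅ (ofBiKummerData h toB Q odd_l R ιX hopen σ K' constEmb constEmb_injective hdivc hdivp).AN)
    (β : Ψ.functor.obj (ofBiKummerData h toB Q odd_l R ιX hopen σ K' constEmb constEmb_injective hdivc hdivp).BN ≅ (ofBiKummerData h toB Q odd_l R ιX hopen σ K' constEmb constEmb_injective hdivc hdivp).BN)
    (eA : (ofBiKummerData h toB Q odd_l R ιX hopen σ K' constEmb constEmb_injective hdivc hdivp).AN ≅ (ofBiKummerData h toB Q odd_l R ιX hopen σ K' constEmb constEmb_injective hdivc hdivp).AN) (Dp : Aut (ofBiKummerData h toB Q odd_l R ιX hopen σ K' constEmb constEmb_injective hdivc hdivp).BN)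
    (θΨ : Aut R.BN.base ≃* Aut R.BN.base)
    (hdiff : (ofBiKummerData h toB Q odd_l R ιX hopen σ K' constEmb constEmb_injective hdivc hdivp).BiKummerDifferenceMem)
    (hT : α.inv ≫ Ψ.functor.map (ofBiKummerData h toB Q odd_l R ιX hopen σ K' constEmb constEmb_injective hdivc hdivp).sCap ≫ β.hom =
      eA.hom ≫ (ofBiKummerData h toB Q odd_l R ιX hopen σ K' constEmb constEmb_injective hdivc hdivp).sCap ≫ (1 : Aut (ofBiKummerData h toB Q odd_l R ιX hopen σ K' constEmb constEmb_injective hdivc hdivp).BN).hom)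
    (hT' : α.inv ≫ Ψ.functor.map (ofBiKummerData h toB Q odd_l R ιX hopen σ K' constEmb constEmb_injective hdivc hdivp).sCup ≫ β.hom =
      eA.hom ≫ (ofBiKummerData h toB Q odd_l R ιX hopen σ K' constEmb constEmb_injective hdivc hdivp).sCup ≫ Dp.hom)
    (hu : Dp ∈ (ofBiKummerData h toB Q odd_l R ιX hopen σ K' constEmb constEmb_injective hdivc hdivp).units (ofBiKummerData h toB Q odd_l R ιX hopen σ K' constEmb constEmb_injective hdivc hdivp).BN)
    (hstrv : (ofBiKummerData h toB Q odd_l R ιX hopen σ K' constEmb constEmb_injective hdivc hdivp).StrvTransport Ψ α eA θΨ)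
    (hYdd : (ofBiKummerData h toB Q odd_l R ιX hopen σ K' constEmb constEmb_injective hdivc hdivp).HB.map θΨ.toMonoidHom = (ofBiKummerData h toB Q odd_l R ιX hopen σ K' constEmb constEmb_injective hdivc hdivp).HB)
    (P : ThetaSubquotientProj (ofBiKummerData h toB Q odd_l R ιX hopen σ K' constEmb constEmb_injective hdivc hdivp))
    -- centrality of the geometric part (T56-L09b at the data)
    (hσ : ∀ g : Aut R.AN.base, ModelFrobenioid.baseMap (σ g).hom = g.hom)
    (hgeom : P.pre R.BN.base ≤ RD.aug.ker.map (rhoOfBiKummerData R ιX))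
    (hconst : ∀ δ ∈ RD.aug.ker, ∀ τ : ModelFrobenioid.units R.BN,
      (S.tf.ratFnFunctor.map (rhoOfBiKummerData R ιX δ).hom.op).hom (ModelFrobenioid.unit τ.1.hom) =
        ModelFrobenioid.unit τ.1.hom)
    -- the row-2 laws of the subquotient datum and coverage (abc-iut-w5-d123 / abc-iut-w5-d013 shapes, verbatim)
    (e : RD.mu → (ofBiKummerData h toB Q odd_l R ιX hopen σ K' constEmb constEmb_injective hdivc hdivp).lDeltaModN (ofBiKummerData h toB Q odd_l R ιX hopen σ K' constEmb constEmb_injective hdivc hdivp).BN)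
    (he : Function.Surjective e)
    (hpre : ∀ k : RD.PiYdd, (k : RD.PiX) ∈ RD.lDeltaTheta → rhoOfBiKummerData R ιX k ∈ P.pre _)
    (hP : ∀ (k : RD.PiYdd) (hk : (k : RD.PiX) ∈ RD.lDeltaTheta) (hm : rhoOfBiKummerData R ιX k ∈ P.pre _),
      (QuotientGroup.mk (P.proj _ ⟨rhoOfBiKummerData R ιX k, hm⟩) : (ofBiKummerData h toB Q odd_l R ιX hopen σ K' constEmb constEmb_injective hdivc hdivp).lDeltaModN (ofBiKummerData h toB Q odd_l R ιX hopen σ K' constEmb constEmb_injective hdivc hdivp).BN) = e (RD.thetaMod ⟨k, hk⟩))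
    (hcov' : ∀ g ∈ P.pre ((ofBiKummerData h toB Q odd_l R ιX hopen σ K' constEmb constEmb_injective hdivc hdivp).base.obj (ofBiKummerData h toB Q odd_l R ιX hopen σ K' constEmb constEmb_injective hdivc hdivp).BN),
      ∃ k : RD.PiYdd, (k : RD.PiX) ∈ RD.lDeltaTheta ∧ rhoOfBiKummerData R ιX k = g)
    -- T56-L09c data (abc-iut-w5-d013): Ψ on (l·Δ_Θ) ⊗ ℤ/N and the printed relations
    (aΨ : ∀ A : S.C, (ofBiKummerData h toB Q odd_l R ιX hopen σ K' constEmb constEmb_injective hdivc hdivp).lDeltaModN A ≃* (ofBiKummerData h toB Q odd_l R ιX hopen σ K' constEmb constEmb_injective hdivc hdivp).lDeltaModN (Ψ.functor.obj A))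
    (γ : RD.PiX ≃ₜ* RD.PiX)
    (hγ : ∀ y : RD.PiX, θΨ (rhoOfBiKummerData R ιX y) = rhoOfBiKummerData R ιX (γ y))
    (hγL : RD.lDeltaTheta.map γ.toMulEquiv.toMonoidHom = RD.lDeltaTheta)
    (haΨ : ∀ (k : RD.PiYdd) (hk : (k : RD.PiX) ∈ RD.lDeltaTheta) (hk' : γ k ∈ RD.lDeltaTheta),
      (ofBiKummerData h toB Q odd_l R ιX hopen σ K' constEmb constEmb_injective hdivc hdivp).lDeltaModNMap β.hom (aΨ _ (e (RD.thetaMod ⟨k, hk⟩))) = e (RD.thetaMod ⟨γ k, hk'⟩))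
    -- the rigidity family with its Prop. 5.5 properties
    (ρ : RigidityFamily (ofBiKummerData h toB Q odd_l R ιX hopen σ K' constEmb constEmb_injective hdivc hdivp))
    (hB : (ofBiKummerData h toB Q odd_l R ιX hopen σ K' constEmb constEmb_injective hdivc hdivp).IsThetaSaturated (ofBiKummerData h toB Q odd_l R ιX hopen σ K' constEmb constEmb_injective hdivc hdivp).BN)
    (hK : IsKummerDetermined (ofBiKummerData h toB Q odd_l R ιX hopen σ K' constEmb constEmb_injective hdivc hdivp) P ρ hB) (hρ : IsFunctorialLinear (ofBiKummerData h toB Q odd_l R ιX hopen σ K' constEmb constEmb_injective hdivc hdivp) ρ)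
    (hΨB : (ofBiKummerData h toB Q odd_l R ιX hopen σ K' constEmb constEmb_injective hdivc hdivp).IsThetaSaturated (Ψ.functor.obj (ofBiKummerData h toB Q odd_l R ιX hopen σ K' constEmb constEmb_injective hdivc hdivp).BN))
    (x : (ofBiKummerData h toB Q odd_l R ιX hopen σ K' constEmb constEmb_injective hdivc hdivp).lDeltaModN (ofBiKummerData h toB Q odd_l R ιX hopen σ K' constEmb constEmb_injective hdivc hdivp).BN) :
    (Ψ.functor.mapAut (ofBiKummerData h toB Q odd_l R ιX hopen σ K' constEmb constEmb_injective hdivc hdivp).BN (ρ (ofBiKummerData h toB Q odd_l R ιX hopen σ K' constEmb constEmb_injective hdivc hdivp).BN hB x : Aut (ofBiKummerData h toB Q odd_l R ιX hopen σ K' constEmb constEmb_injective hdivc hdivp).BN) : Aut (Ψ.functor.obj (ofBiKummerData h toB Q odd_l R ιX hopen σ K' constEmb constEmb_injective hdivc hdivp).BN)) =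
      ρ (Ψ.functor.obj (ofBiKummerData h toB Q odd_l R ιX hopen σ K' constEmb constEmb_injective hdivc hdivp).BN) hΨB (aΨ (ofBiKummerData h toB Q odd_l R ιX hopen σ K' constEmb constEmb_injective hdivc hdivp).BN x) := by
  haveI : Epi (ofBiKummerData h toB Q odd_l R ιX hopen σ K' constEmb constEmb_injective hdivc hdivp).sCap := epi_of_model (DivB := S.tf.divBNatTrans) h _
  haveI : Epi (ofBiKummerData h toB Q odd_l R ιX hopen σ K' constEmb constEmb_injective hdivc hdivp).sCup := epi_of_model (DivB := S.tf.divBNatTrans) h _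
  exact Thm56Sub.transportAtBN_of Ψ α β eA Dp θΨ
    (sgpCapSpec_ofBiKummerData h toB Q odd_l R ιX hopen σ K' constEmb constEmb_injective hdivc hdivp)
    (sgpCupSpec_ofBiKummerData h toB Q odd_l R ιX hopen σ K' constEmb constEmb_injective hdivc hdivp)
    hdiff hT hT' hu hstrv hYdd P
    (unitsCentralUnderLDelta_ofBiKummerData h toB Q odd_l R ιX hopen σ K' constEmb constEmb_injective hdivc hdivp
      hσ P hgeom hconst)
    (unitsPullSpec_ofBiKummerData h toB Q odd_l R ιX hopen σ K' constEmb constEmb_injective hdivc hdivp) aΨ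
    (Thm56Sub.deltaTransportCompat_ofBiKummerData h toB Q odd_l R ιX hopen σ K' constEmb constEmb_injective hdivc hdivp e P hpre
      hP hcov' Ψ β aΨ θΨ γ hγ hγL haΨ)
    ρ hB hK hρ
    (lDeltaCovered_ofBiKummerData h toB Q odd_l R ιX hopen σ K' constEmb constEmb_injective hdivc hdivp e he P hpre hP)
    hΨB x

end ThetaFrobenioid

end Literature.AnabelianGeometry.EtaleTheta
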